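import Summits.ABC.IUTFork.Conditional.WRowFrey283Packages
import Summits.ABC.IUTFork.Cor312LicenceWildInhabitedTriple
import Summits.ABC.IUTFork.Cor312GenuineKCyclotomicLowerBound
import Summits.ABC.IUTFork.Cor312GenuineKWildLowerBound
import Literature.IUT.LogVolume.GenuineLogThetaPointDegrees
import Literature.IUT.LogVolume.Corollary22PartIIUpTo
import HarnessLib

/-!
# R-W WINDOW-TABLE, W1 ROW 5 (`7³ + 3¹⁰ = 2¹¹·29` at `l = 29`) — PACKAGES: symbolic integer cells, isometric conjugacy of the bad fibre,
# the cheap outer member, and the bad primes / pole orders of `j(343/59392)`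

PROOF-ONLY file (D-0012; 0 definitions, 0 `Prop` facts) of the abc-iut cell — D-0079 RESCUE sub-cell R-W «WINDOW Θ-SIDE INEQUALITY», lane P+
«prove S_H per datum», seat abc-iut-w4-d094 (gen 7); packages for row 5 of HOME/plan/rescue/R-W/OPEN-10.md (sha16 1b0025ee7a8ba6d7):
`pilotDataOfK:frey-343-59049-59392:29` (consumer: `WRowFrey343Inhabited.lean`, the UNCONDITIONAL inhabited-side row theorem). Pattern of
abc-iut-W-row-1's `WRowFrey283Packages` (whose generic local lemmas `WRow.inner_witness_trivial` etc. are consumed BY NAME), over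
abc-iut-W-row-2's `Cor312LicenceWildInhabitedTriple` and abc-iut-w5-d056's `RescaledCompletionGaloisTransport`. TAKES NO SIDE on [IUTchIII]
Cor. 3.12 or on any author.

* §1 `WRow.cell_frey343_three` / `WRow.cell_frey343_seven` — the socket's integer cells `e·⌊(j²P − j·D − (j+1)·ρin)/e⌋ + (j+1)·ρout ≤ P` for
  EVERY ramification index of the admissible shape (`e = 174n` over `3`, `e = 29n` over `7`, `n ≥ 1`) at every label `j ≤ 14`, with the cheap
  one-sided data `D = e − 1`, `ρin = 1`, `ρout = min(p^a − a·e, p^b − b·e)` (`nlinarith` after dropping the floor).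
* §2 `WRow.absRamificationIdx_eq_of_algEquiv_norm_eq` (an ISOMETRIC `ℚ_p`-algebra isomorphism preserves `e`: norm uniformizers are a
  norm-defined notion, `‖ϖ‖ = p^{−1/e}`); `WRow.exists_algEquiv_kOf_norm_eq_of_finrank_eq_one` (abc-iut-W-row-2's conjugacy of the fibre at
  `d_mod = 1`, re-proved KEEPING the isometry that `RescaledCompletion.exists_algEquiv_norm_eq_of_under_eq` provides) ⇒
  `WRow.absRamificationIdx_kOf_eq_of_finrank_eq_one` (uniform `e` over the fibre); `WRow.exists_mem_logUnits_rpow_min_le_norm` (a member of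
  `log_p(𝒪^×)` of norm `≥ p^{−min(p^a − a·e, p^b − b·e)/e}` off the cyclotomic indices: abc-iut-c312-3's envelope member + `envelope_le_index`).
* §3 `WRow.bad_prime_frey343` — a bad fibre point of a datum over `(ratPoint (343/59392), 29)` lies over `3` (`ord₃ j = −20`) or `7`
  (`ord₇ j = −6`): `j(343/59392) = 3507155857³/(2¹⁴·3²⁰·7⁶·29²)` (abc-iut-S6's Frey formula + abc-iut-c312-d1's rational-point dictionary),
  `‖t_q(x)‖ < 1` at a bad place (abc-iut-w4-d026), `p ≠ 2, l` (abc-iut-C-cert-3).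
HONEST SCOPE: classical local/global number theory plus the cell's typed containers; nothing here bears on the printed inequality; typed ≠
proved elsewhere; no abc claim. [cite: Mochizuki2012, IUTchI Def. 3.1 (b),(c) pp. 61–62, Rmk. 3.1.5 p. 65; IUTchIV Prop. 1.1 p. 9, Prop. 1.2 (i)(ii)
p. 10, Cor. 2.2 (ii) proof (P5) p. 46] [cite: DupuyHilado2025, §3.3, §3.4, §4.9] [cite: NeukirchANT1999, Ch. II (5.5)]
[cite: CasselsFrohlichANT1967, Ch. VII §1.1, Prop. 1.2 (ii)] [cite: SilvermanAEC2009, Prop. III.1.7(b)] [cite: MochizukiGenEll2010, Def. 3.3 p. 12]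
[claim: Mochizuki2012, status: disputed] for the IUT locutions only.
-/

noncomputable section

open Set Function Metric NumberField IsDedekindDomain

namespace Summit.ABC.IUTFork.Conditional

open Thm311 Thm311.Real Cor312 Cor312Vol Cor312Prov Literature.IUT.LogThetaLattice Literature.IUT.LogVolume
  Literature.IUT.HodgeTheaters Literature.IUT.LogVolume.Cor22
open Literature.NumberTheory.NumberFields Literature.NumberTheory.GaloisRepresentations.Ultrametric
open Literature.NumberTheory.DiophantineGeometry Literature.NumberTheory.DiophantineGeometry.GenEll

/-! ## §1. The integer cells for EVERY admissible ramification index (symbolic `e`) -/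

/-- **The cells over `3`, all `e = 174·n`** (`P = 10e/29 = 60n`, `D = e − 1`, `ρin = 1`, `ρout ≤ 3^4 − 4e ∧ ρout ≤ 3^5 − 5e`): at every label
`j = i + 1 ≤ 14`, `e·⌊(j²P − j·D − (j+1))/e⌋ + (j+1)·ρout ≤ P`. Tightest case `n = 1`, `j = 14` (exact LHS `−183 ≤ 60`). [folklore] -/
theorem WRow.cell_frey343_three {n : ℕ} (hn : 1 ≤ n) (i : ℕ) (hi : i < 14) :
    ((174 * n : ℕ) : ℤ) *
          ((((i + 1 : ℕ) : ℤ) ^ 2 * ((174 * n * 20 / (2 * 29) : ℕ) : ℤ) - ((i + 1 : ℕ) : ℤ) * ((174 * n - 1 : ℕ) : ℤ) -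
              ((i + 2 : ℕ) : ℤ) * (1 : ℤ)) / ((174 * n : ℕ) : ℤ)) +
        ((i + 2 : ℕ) : ℤ) * min ((3 : ℤ) ^ 4 - 4 * ((174 * n : ℕ) : ℤ)) ((3 : ℤ) ^ 5 - 5 * ((174 * n : ℕ) : ℤ)) ≤
      ((174 * n * 20 / (2 * 29) : ℕ) : ℤ) := by
  have he0 : (0 : ℤ) < ((174 * n : ℕ) : ℤ) := by positivity
  have hP : (174 * n * 20 / (2 * 29) : ℕ) = 60 * n := by omega
  have hfloor := Int.mul_ediv_self_le (k := ((174 * n : ℕ) : ℤ))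
    (x := (((i + 1 : ℕ) : ℤ) ^ 2 * ((174 * n * 20 / (2 * 29) : ℕ) : ℤ) - ((i + 1 : ℕ) : ℤ) * ((174 * n - 1 : ℕ) : ℤ) -
      ((i + 2 : ℕ) : ℤ) * (1 : ℤ))) he0.ne'
  have hsub : ((174 * n - 1 : ℕ) : ℤ) = 174 * n - 1 := by
    rw [Nat.cast_sub (by omega)]; push_cast; ring
  rw [hsub, hP] at hfloor ⊢
  have hmin1 : min ((3 : ℤ) ^ 4 - 4 * ((174 * n : ℕ) : ℤ)) ((3 : ℤ) ^ 5 - 5 * ((174 * n : ℕ) : ℤ)) ≤ (81 : ℤ) - 4 * (174 * (n : ℤ)) :=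
    (min_le_left _ _).trans (by push_cast; exact le_rfl)
  have hmin2 : min ((3 : ℤ) ^ 4 - 4 * ((174 * n : ℕ) : ℤ)) ((3 : ℤ) ^ 5 - 5 * ((174 * n : ℕ) : ℤ)) ≤ (243 : ℤ) - 5 * (174 * (n : ℤ)) :=
    (min_le_right _ _).trans (by push_cast; exact le_rfl)
  generalize min ((3 : ℤ) ^ 4 - 4 * ((174 * n : ℕ) : ℤ)) ((3 : ℤ) ^ 5 - 5 * ((174 * n : ℕ) : ℤ)) = ρ at hmin1 hmin2 ⊢
  interval_cases i <;> push_cast at hfloor ⊢ <;> nlinarith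

/-- **The cells over `7`, all `e = 29·n`** (`P = 3e/29 = 3n`, `D = e − 1`, `ρin = 1`, `ρout ≤ 7 − e ∧ ρout ≤ 49 − 2e`), every label `j ≤ 14`.
[folklore] -/
theorem WRow.cell_frey343_seven {n : ℕ} (hn : 1 ≤ n) (i : ℕ) (hi : i < 14) :
    ((29 * n : ℕ) : ℤ) *
          ((((i + 1 : ℕ) : ℤ) ^ 2 * ((29 * n * 6 / (2 * 29) : ℕ) : ℤ) - ((i + 1 : ℕ) : ℤ) * ((29 * n - 1 : ℕ) : ℤ) -
              ((i + 2 : ℕ) : ℤ) * (1 : ℤ)) / ((29 * n : ℕ) : ℤ)) +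
        ((i + 2 : ℕ) : ℤ) * min ((7 : ℤ) ^ 1 - 1 * ((29 * n : ℕ) : ℤ)) ((7 : ℤ) ^ 2 - 2 * ((29 * n : ℕ) : ℤ)) ≤
      ((29 * n * 6 / (2 * 29) : ℕ) : ℤ) := by
  have he0 : (0 : ℤ) < ((29 * n : ℕ) : ℤ) := by positivity
  have hP : (29 * n * 6 / (2 * 29) : ℕ) = 3 * n := by omega
  have hfloor := Int.mul_ediv_self_le (k := ((29 * n : ℕ) : ℤ))
    (x := (((i + 1 : ℕ) : ℤ) ^ 2 * ((29 * n * 6 / (2 * 29) : ℕ) : ℤ) - ((i + 1 : ℕ) : ℤ) * ((29 * n - 1 : ℕ) : ℤ) -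
      ((i + 2 : ℕ) : ℤ) * (1 : ℤ))) he0.ne'
  have hsub : ((29 * n - 1 : ℕ) : ℤ) = 29 * n - 1 := by
    rw [Nat.cast_sub (by omega)]; push_cast; ring
  rw [hsub, hP] at hfloor ⊢
  have hmin1 : min ((7 : ℤ) ^ 1 - 1 * ((29 * n : ℕ) : ℤ)) ((7 : ℤ) ^ 2 - 2 * ((29 * n : ℕ) : ℤ)) ≤ (7 : ℤ) - 1 * (29 * (n : ℤ)) :=
    (min_le_left _ _).trans (by push_cast; exact le_rfl)
  have hmin2 : min ((7 : ℤ) ^ 1 - 1 * ((29 * n : ℕ) : ℤ)) ((7 : ℤ) ^ 2 - 2 * ((29 * n : ℕ) : ℤ)) ≤ (49 : ℤ) - 2 * (29 * (n : ℤ)) :=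
    (min_le_right _ _).trans (by push_cast; exact le_rfl)
  generalize min ((7 : ℤ) ^ 1 - 1 * ((29 * n : ℕ) : ℤ)) ((7 : ℤ) ^ 2 - 2 * ((29 * n : ℕ) : ℤ)) = ρ at hmin1 hmin2 ⊢
  interval_cases i <;> push_cast at hfloor ⊢ <;> nlinarith

/-! ## §2. Local lemmas: isometric `ℚ_p`-isomorphisms preserve `e`; conjugate bad fibre with an isometry; the outer member below two
envelope terms -/

section Local

variable (p : ℕ) [hp : Fact p.Prime] {K : Type} [NontriviallyNormedField K] [instK : NormedAlgebra ℚ_[p] K]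
  [IsUltrametricDist K] [ProperSpace K] {K' : Type} [NontriviallyNormedField K'] [instK' : NormedAlgebra ℚ_[p] K']
  [IsUltrametricDist K'] [ProperSpace K']

include instK instK' in
/-- **An isometric `ℚ_p`-algebra isomorphism preserves the absolute ramification index**: it carries a norm uniformizer `ϖ` of `K` (a
norm-defined notion) to a norm uniformizer of `K'` of the same norm, and `‖ϖ‖ = p^{−1/e}` pins `e` (`norm_eq_rpow_of_isUniformizer`).
[cite: CasselsFrohlichANT1967, Ch. VII §1.1] -/
theorem WRow.absRamificationIdx_eq_of_algEquiv_norm_eq (g : K ≃ₐ[ℚ_[p]] K') (hg : ∀ x, ‖g x‖ = ‖x‖) :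
    absRamificationIdx p K = absRamificationIdx p K' := by
  obtain ⟨ϖ, hϖ⟩ := exists_isUniformizer (F := K)
  have hg0 : g (ϖ : K) ≠ 0 := by
    intro h
    have := hg (ϖ : K)
    rw [h, norm_zero] at this
    exact (norm_units_pos ϖ).ne' this.symm
  set ϖ' : K'ˣ := Units.mk0 (g (ϖ : K)) hg0 with hϖ'def
  have hϖ' : IsUniformizer ϖ' := by
    refine ⟨by rw [hϖ'def, Units.val_mk0, hg]; exact hϖ.1, fun y => ?_⟩
    have hy0 : g.symm (y : K') ≠ 0 := by
      intro h
      have h' : (y : K') = 0 := by rw [← g.apply_symm_apply (y : K'), h, map_zero]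
      exact y.ne_zero h'
    obtain ⟨k, hk⟩ := hϖ.2 (Units.mk0 _ hy0)
    refine ⟨k, ?_⟩
    rw [Units.val_mk0] at hk
    rw [hϖ'def, Units.val_mk0, hg, ← hk, ← hg, g.apply_symm_apply]
  have h1 := norm_eq_rpow_of_isUniformizer p K hϖ
  have h2 := norm_eq_rpow_of_isUniformizer p K' hϖ'
  rw [hϖ'def, Units.val_mk0, hg, h1] at h2
  have hp1 : (1 : ℝ) < p := by exact_mod_cast hp.out.one_lt
  have he : (0 : ℝ) < absRamificationIdx p K := by exact_mod_cast absRamificationIdx_pos p K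
  have he' : (0 : ℝ) < absRamificationIdx p K' := by exact_mod_cast absRamificationIdx_pos p K'
  have hexp : -(1 / (absRamificationIdx p K : ℝ)) = -(1 / (absRamificationIdx p K' : ℝ)) := by
    rcases lt_trichotomy (-(1 / (absRamificationIdx p K : ℝ))) (-(1 / (absRamificationIdx p K' : ℝ))) with hlt | heq | hgt
    · exact absurd h2 (ne_of_lt ((Real.rpow_lt_rpow_left_iff hp1).mpr hlt))
    · exact heq
    · exact absurd h2 (ne_of_gt ((Real.rpow_lt_rpow_left_iff hp1).mpr hgt))
  have hee : (absRamificationIdx p K : ℝ) = (absRamificationIdx p K' : ℝ) := by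
    have h := neg_injective hexp
    rw [div_eq_div_iff he.ne' he'.ne', one_mul, one_mul] at h
    exact h.symm
  exact_mod_cast hee

include instK in
/-- **Outer member below two envelope terms**: off the cyclotomic indices (`e ≠ p^c·(p−1)` for all `c`), `log_p(𝒪_K^×)` contains an element
of norm `≥ p^{−min(p^a − a·e, p^b − b·e)/e}` — the envelope member `log_p(1+ϖ)` of norm `‖ϖ‖^{p^{a₀} − e·a₀}` at the strict turning point `a₀`
(abc-iut-c312-3 `LogEnvelope.exists_mem_logUnits_norm_eq_envelope`), with `p^{a₀} − e·a₀ ≤ p^c − c·e` for EVERY `c` (`envelope_le_index`).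
[cite: NeukirchANT1999, Ch. II (5.5)] -/
theorem WRow.exists_mem_logUnits_rpow_min_le_norm {e : ℕ} (he : absRamificationIdx p K = e)
    (hne : ∀ c : ℕ, (e : ℤ) ≠ (p : ℤ) ^ c * ((p : ℤ) - 1)) (a b : ℕ) :
    ∃ z ∈ logUnits K,
      (p : ℝ) ^ (-(((min ((p : ℤ) ^ a - a * (e : ℤ)) ((p : ℤ) ^ b - b * (e : ℤ)) : ℤ) : ℝ) / (e : ℝ))) ≤ ‖z‖ := by
  subst he
  obtain ⟨ϖ, hϖ⟩ := exists_isUniformizer (F := K)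
  obtain ⟨a₀, hlo, hhi⟩ := LogEnvelope.exists_strict_turning_of_forall_ne (p := p) hne
  obtain ⟨z, hz, hzn⟩ := LogEnvelope.exists_mem_logUnits_norm_eq_envelope p hϖ hlo hhi
  refine ⟨z, hz, ?_⟩
  have henv : ∀ c : ℕ, (p : ℤ) ^ a₀ - (absRamificationIdx p K : ℤ) * (a₀ : ℤ) ≤
      (p : ℤ) ^ c - c * (absRamificationIdx p K : ℤ) := by
    intro c
    have h := LogEnvelope.envelope_le_index (p := p) (K := K) hlo hhi.le (s := 1) le_rfl (p ^ c - 1)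
    have hpc : p ^ c - 1 + 1 = p ^ c := Nat.sub_add_cancel (Nat.one_le_pow _ _ hp.out.pos)
    rw [hpc, padicValNat.prime_pow, one_mul] at h
    push_cast at h
    linarith
  have hle : (p : ℤ) ^ a₀ - (absRamificationIdx p K : ℤ) * (a₀ : ℤ) ≤
      min ((p : ℤ) ^ a - a * (absRamificationIdx p K : ℤ)) ((p : ℤ) ^ b - b * (absRamificationIdx p K : ℤ)) :=
    le_min (henv a) (henv b)
  have hp1 : (1 : ℝ) ≤ (p : ℝ) := by exact_mod_cast hp.out.one_lt.le
  have he0 : (0 : ℝ) < (absRamificationIdx p K : ℝ) := by exact_mod_cast absRamificationIdx_pos p K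
  have hle' : (((p : ℤ) ^ a₀ - (absRamificationIdx p K : ℤ) * (a₀ : ℤ) : ℤ) : ℝ) ≤
      ((min ((p : ℤ) ^ a - a * (absRamificationIdx p K : ℤ)) ((p : ℤ) ^ b - b * (absRamificationIdx p K : ℤ)) : ℤ) : ℝ) := by
    exact_mod_cast hle
  rw [hzn, norm_isUniformizer_zpow_eq_rpow p hϖ]
  refine Real.rpow_le_rpow_of_exponent_le hp1 ?_
  rw [neg_le_neg_iff]
  exact div_le_div_of_nonneg_right hle' he0.le

end Local

section Conjugate

variable {F K Fbar : Type} [Field F] [NumberField F] [Field K] [NumberField K] [Algebra F K] [Field Fbar]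
  [Algebra F Fbar] [Algebra K Fbar] {E : WeierstrassCurve F} [E.IsElliptic] {l : ℕ} {Pb : BadPlacePredicates K}
  (D : InitialThetaData F K Fbar E l Pb)

/-- **Conjugacy of the fibre WITH THE ISOMETRY, at `d_mod = 1`** (abc-iut-W-row-2's `Cor312Prov.nonempty_algEquiv_kOf_of_finrank_eq_one`, whose
proof is repeated keeping the norm-compatibility that abc-iut-w5-d056's `RescaledCompletion.exists_algEquiv_norm_eq_of_under_eq` provides):
`K/F_mod` Galois ([IUTchI] Rmk. 3.1.5), one place of `F_mod` over `p`, Galois transport of the rescaled completions.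
[cite: Mochizuki2012, IUTchI Rmk. 3.1.5 p. 65] [cite: CasselsFrohlichANT1967, Ch. VII Prop. 1.2 (ii)] -/
theorem WRow.exists_algEquiv_kOf_norm_eq_of_finrank_eq_one (hF : Module.finrank ℚ (fieldOfModuli E) = 1) (pp : Nat.Primes)
    (x y : (thetaIndex (pilotDataOfK D K)).Fibre (.inr pp)) :
    haveI : Fact (pp : ℕ).Prime := ⟨pp.2⟩
    ∃ g : kOf (pilotDataOfK D K) pp.1 x ≃ₐ[ℚ_[pp]] kOf (pilotDataOfK D K) pp.1 y, ∀ z, ‖g z‖ = ‖z‖ := by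
  haveI : Fact (pp : ℕ).Prime := ⟨pp.2⟩
  haveI : IsGalois (fieldOfModuli E) K := D.isGalois_fieldOfModuli_K
  have hcard : (placesOver (fieldOfModuli E) (pp : ℕ)).card ≤ 1 :=
    (PilotData.card_placesOver_le_finrank (F := fieldOfModuli E) (pp : ℕ)).trans hF.le
  have hx := finBelow_mem_placesOver (fieldOfModuli E) K (placeOf_mem (pilotDataOfK D K) pp.1 x)
  have hy := finBelow_mem_placesOver (fieldOfModuli E) K (placeOf_mem (pilotDataOfK D K) pp.1 y)
  have hv : finBelow (fieldOfModuli E) K (placeOf (pilotDataOfK D K) pp.1 x) =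
      finBelow (fieldOfModuli E) K (placeOf (pilotDataOfK D K) pp.1 y) := Finset.card_le_one.mp hcard _ hx _ hy
  have hunder : (placeOf (pilotDataOfK D K) pp.1 x).under (𝓞 (fieldOfModuli E)) =
      (placeOf (pilotDataOfK D K) pp.1 y).under (𝓞 (fieldOfModuli E)) := by
    rw [← finBelow_eq_under (fieldOfModuli E) K, ← finBelow_eq_under (fieldOfModuli E) K, hv]
  exact RescaledCompletion.exists_algEquiv_norm_eq_of_under_eq (F₀ := fieldOfModuli E) (p := (pp : ℕ))
    (placeOf (pilotDataOfK D K) pp.1 x) (placeOf (pilotDataOfK D K) pp.1 y) (natCast_mem_placeOf (pilotDataOfK D K) pp.1 x)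
    (natCast_mem_placeOf (pilotDataOfK D K) pp.1 y) hunder

/-- **Uniform ramification over the bad fibre at `d_mod = 1`**: any two fibre points over the same prime have the same `e(K_x/ℚ_p)`.
[cite: CasselsFrohlichANT1967, Ch. VII §1.1, Prop. 1.2 (ii)] -/
theorem WRow.absRamificationIdx_kOf_eq_of_finrank_eq_one (hF : Module.finrank ℚ (fieldOfModuli E) = 1) (pp : Nat.Primes)
    (x y : (thetaIndex (pilotDataOfK D K)).Fibre (.inr pp)) :
    haveI : Fact (pp : ℕ).Prime := ⟨pp.2⟩
    absRamificationIdx (pp : ℕ) (kOf (pilotDataOfK D K) pp.1 x) = absRamificationIdx (pp : ℕ) (kOf (pilotDataOfK D K) pp.1 y) := by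
  haveI : Fact (pp : ℕ).Prime := ⟨pp.2⟩
  obtain ⟨g, hg⟩ := WRow.exists_algEquiv_kOf_norm_eq_of_finrank_eq_one D hF pp x y
  exact WRow.absRamificationIdx_eq_of_algEquiv_norm_eq (pp : ℕ) g hg

end Conjugate

/-! ## §3. The triple `7³ + 3¹⁰ = 2¹¹·29`: pole orders of `j(343/59392)` and the bad primes at `l = 29` -/

/-- The known abc triple `343 + 59049 = 59392`, i.e. `7³ + 3¹⁰ = 2¹¹·29` (R-W numerics, HOME/plan/rescue/R-W/OPEN-10.md row 5). [folklore] -/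
theorem isABCTriple_frey343 : IsABCTriple 343 59049 59392 := by
  refine ⟨by norm_num, by norm_num, by norm_num, ?_⟩
  rw [Nat.coprime_iff_gcd_eq_one]
  decide

/-- The denominator of `j(343/59392) = M³/(2¹⁴·3²⁰·7⁶·29²)`, `M = 59392·59049 + 343² = 3507155857`. [folklore] -/
theorem WRow.den_frey343 :
    (2 ^ 14 * 3 ^ 20 * 7 ^ 6 * 29 ^ 2 : ℕ) =
      ∏ p ∈ ({2, 3, 7, 29} : Finset ℕ), p ^ (if p = 2 then 14 else if p = 3 then 20 else if p = 7 then 6 else 2) := by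
  decide

/-- `j(343/59392) = 3507155857³ / (2¹⁴·3²⁰·7⁶·29²)` (the Frey formula `2⁸(cb + a²)³/(abc)²`, abc-iut-S6's `Cor22.jInv_ratPoint_triple`, reduced by
`2⁸`). [cite: SilvermanAEC2009, Prop. III.1.7(b)] -/
theorem WRow.jInv_frey343 :
    jInv ((343 : ℚ) / 59392) = ((3507155857 ^ 3 : ℕ) : ℚ) / ((2 ^ 14 * 3 ^ 20 * 7 ^ 6 * 29 ^ 2 : ℕ) : ℚ) := by
  have h := jInv_ratPoint_triple isABCTriple_frey343
  push_cast at h ⊢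
  rw [h]
  norm_num

/-- **`ord_p j(343/59392)`** at the places of `ℚ` over `p ∈ {3, 7, 29}`: `−20`, `−6`, `−2`. [cite: MochizukiGenEll2010, Def. 3.3 p. 12] -/
theorem WRow.ord_jInv_frey343 (v : HeightOneSpectrum (𝓞 ℚ)) {p₀ : ℕ} (hv : Rat.HeightOneSpectrum.natGenerator v = p₀)
    (hp₀ : p₀ = 3 ∨ p₀ = 7 ∨ p₀ = 29) :
    ord ℚ v (jInv ((343 : ℚ) / 59392)) = -((if p₀ = 2 then 14 else if p₀ = 3 then 20 else if p₀ = 7 then 6 else 2 : ℕ) : ℤ) := by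
  have hI : ∀ p ∈ ({2, 3, 7, 29} : Finset ℕ), p.Prime := by
    intro p hp
    simp only [Finset.mem_insert, Finset.mem_singleton] at hp
    rcases hp with rfl | rfl | rfl | rfl <;> norm_num
  have hmem : p₀ ∈ ({2, 3, 7, 29} : Finset ℕ) := by
    simp only [Finset.mem_insert, Finset.mem_singleton]
    rcases hp₀ with h | h | h <;> simp [h]
  have hcop : ¬ p₀ ∣ 3507155857 ^ 3 := by
    intro h
    rcases hp₀ with rfl | rfl | rfl
    · exact absurd (Nat.Prime.dvd_of_dvd_pow Nat.prime_three h) (by norm_num)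
    · exact absurd (Nat.Prime.dvd_of_dvd_pow (by norm_num : Nat.Prime 7) h) (by norm_num)
    · exact absurd (Nat.Prime.dvd_of_dvd_pow (by norm_num : Nat.Prime 29) h) (by norm_num)
  subst hv
  exact ord_jInv_ratPoint_of_mem hI WRow.den_frey343 WRow.jInv_frey343 (by norm_num) v hmem hcop

/-- The POLES of `j(343/59392)` lie over `{2, 3, 7, 29}`. [cite: MochizukiGenEll2010, Def. 3.3 p. 12] -/
theorem WRow.natGenerator_mem_of_ord_neg_frey343 (v : HeightOneSpectrum (𝓞 ℚ)) (hneg : ord ℚ v (jInv ((343 : ℚ) / 59392)) < 0) :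
    Rat.HeightOneSpectrum.natGenerator v ∈ ({2, 3, 7, 29} : Finset ℕ) := by
  by_contra hv
  have hI : ∀ p ∈ ({2, 3, 7, 29} : Finset ℕ), p.Prime := by
    intro p hp
    simp only [Finset.mem_insert, Finset.mem_singleton] at hp
    rcases hp with rfl | rfl | rfl | rfl <;> norm_num
  have := ord_jInv_ratPoint_nonneg_of_not_mem hI WRow.den_frey343 WRow.jInv_frey343 (by norm_num) v hv
  omega

/-- **Which primes carry bad fibre points at `(ratPoint (343/59392), 29)`, and the pole order there**: a bad `x | p` forces `p ∈ {3, 7}`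
(`‖t_q(x)‖ < 1` for the chosen realising q-idele, i.e. a pole of `j`; `p ≠ 2`; `p ≠ l = 29`), with `ord₃ j = −20`, `ord₇ j = −6`.
[cite: Mochizuki2012, IUTchIV Cor. 2.2 (ii) proof (P5) p. 46] -/
theorem WRow.bad_prime_frey343 (T : Cor22.ThetaVolumeDatumAt (ratPoint ((343 : ℚ) / 59392)) 29) (pp : Nat.Primes) :
    letI := T.instFieldF; letI := T.instNumberFieldF; letI := T.instAlgebraF; letI := T.instFieldK
    letI := T.instNumberFieldK; letI := T.instAlgebraK; letI := T.instFieldFbar; letI := T.instAlgebraFbar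
    letI := T.instAlgebraKFbar; letI := T.instIsElliptic
    haveI : Fact (pp : ℕ).Prime := ⟨pp.2⟩
    ∀ x : (thetaIndex (pilotDataOfK T.D T.K)).Fibre (.inr pp), placeOf (pilotDataOfK T.D T.K) pp.1 x ∈ (pilotDataOfK T.D T.K).S →
      ((pp : ℕ) = 3 ∧ ord ℚ (finBelow ℚ T.K (placeOf (pilotDataOfK T.D T.K) pp.1 x)) (jInv ((343 : ℚ) / 59392)) = -20) ∨
      ((pp : ℕ) = 7 ∧ ord ℚ (finBelow ℚ T.K (placeOf (pilotDataOfK T.D T.K) pp.1 x)) (jInv ((343 : ℚ) / 59392)) = -6) := by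
  letI := T.instFieldF; letI := T.instNumberFieldF; letI := T.instAlgebraF; letI := T.instFieldK
  letI := T.instNumberFieldK; letI := T.instAlgebraK; letI := T.instFieldFbar; letI := T.instAlgebraFbar
  letI := T.instAlgebraKFbar; letI := T.instIsElliptic
  haveI : Fact (pp : ℕ).Prime := ⟨pp.2⟩
  intro x hx
  have hjF : T.E.j = ((jInv ((343 : ℚ) / 59392) : ℚ) : T.F) := by rw [T.j_eq]; exact eq_ratCast _ _
  have hp1 : (1 : ℝ) < ((pp : ℕ) : ℝ) := by exact_mod_cast pp.2.one_lt
  have hgen := natGenerator_finBelow_placeOf T.D pp x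
  -- a pole of `j` under the bad place
  have hneg : ord ℚ (finBelow ℚ T.K (placeOf (pilotDataOfK T.D T.K) pp.1 x)) (jInv ((343 : ℚ) / 59392)) < 0 := by
    have hlt := norm_chosenQIdele_lt_one T.D pp x hx
    rw [norm_chosenQIdele_eq_rpow_ord_rat' T.D pp x hx _ hjF] at hlt
    by_contra hge
    push Not at hge
    have hl : (0 : ℝ) < 2 * (29 : ℕ) := by positivity
    have hexp : (0 : ℝ) ≤ (ord ℚ (finBelow ℚ T.K (placeOf (pilotDataOfK T.D T.K) pp.1 x)) (jInv ((343 : ℚ) / 59392)) : ℝ) /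
        (2 * (29 : ℕ)) := div_nonneg (by exact_mod_cast hge) hl.le
    have h1 := (Real.rpow_le_rpow_left_iff hp1).mpr hexp
    rw [Real.rpow_zero] at h1
    linarith
  have hmem := WRow.natGenerator_mem_of_ord_neg_frey343 _ hneg
  rw [hgen] at hmem
  obtain ⟨h2, hl'⟩ := ne_two_and_ne_l_of_placeOf_mem_S_pilotDataOfK T.D pp x hx
  simp only [Finset.mem_insert, Finset.mem_singleton] at hmem
  have hord : ∀ {p₀ : ℕ}, (pp : ℕ) = p₀ → (p₀ = 3 ∨ p₀ = 7 ∨ p₀ = 29) →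
      ord ℚ (finBelow ℚ T.K (placeOf (pilotDataOfK T.D T.K) pp.1 x)) (jInv ((343 : ℚ) / 59392)) =
        -((if p₀ = 2 then 14 else if p₀ = 3 then 20 else if p₀ = 7 then 6 else 2 : ℕ) : ℤ) :=
    fun hp hp₀ => WRow.ord_jInv_frey343 _ (hgen.trans hp) hp₀
  rcases hmem with h | h | h | h
  · exact absurd h h2
  · exact Or.inl ⟨h, by simpa using hord h (by norm_num)⟩
  · exact Or.inr ⟨h, by simpa using hord h (by norm_num)⟩
  · exact absurd h hl'

end Summit.ABC.IUTFork.Conditional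

end
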